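import Mathlib.Analysis.SpecialFunctions.SmoothTransition
import Mathlib.Analysis.InnerProductSpace.Calculus
import Mathlib.Analysis.Calculus.Deriv.MeanValue
import Mathlib.Analysis.Calculus.FDeriv.Mul
import HarnessLib

/-!
# A star-shaped region with smooth radial function is a smoothly embedded disc

Model-space (pure calculus) toolkit, in a real inner product space `F`: given a **radial function**
`R : F → ℝ`, positively homogeneous of degree `0` (`R (s • x) = R x`, `s > 0`), `C^∞` away from
`0`, and bounded below by a positive constant `c₁ ≤ R`, the **star-shaped region**
`{0} ∪ {y ≠ 0 | ‖y‖ ≤ R y}` bounded by the radial graph `{y ≠ 0 | ‖y‖ = R y}` is the image of the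
closed unit ball under the explicit map

  `starMap R c x = (c + χ(‖x‖²) (R x - c)) • x`,   `c = c₁ / 2`,

`χ = smoothTransition ((16 s - 1)/3)` (`= 0` for `s ≤ 1/16`, `= 1` for `s ≥ 1/4`), which is

* `C^∞` on all of `F` (`contDiff_starMap`; near `0` it is the homothety `c • id`),
* injective (`starMap_injective`; it preserves rays, and along the ray of a unit vector `u` it is
  `s ↦ φᵤ(s) • u` with `φᵤ(s) = s (c + χ(s²)(R u - c))` strictly increasing, `φᵤ' ≥ c > 0`),
* an immersion: `fderiv (starMap R c) x` is injective for every `x` (`fderiv_starMap_injective`;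
  at `x ≠ 0`, `D_x v = g x • v + (Dg_x v) • x` with `g > 0` and `g x + Dg_x x > 0` because the
  radial derivative of `R` vanishes),
* and maps the unit ball onto the star region and the unit sphere onto the radial graph
  (`starMap_image_closedBall`, `starMap_image_sphere`).

This is the standard "radial graph over the sphere bounds a smooth disc" device (e.g. Hirsch,
*Differential Topology* (1976), Ch. 8, radial isotopies; Milnor, *Lectures on the h-cobordism
theorem* (1965), §9 for twisted spheres `Dⁿ ∪ Dⁿ`), used for the second disc of the base of a
great-sphere fibration (`Literature/Geometry/Riemannian/GreatSphereFibrationTwoDiscCover.lean`,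
Hähl 1987 Prop. 4.7). Everything is proved; the definitions are explicit.

## References

* M. W. Hirsch, *Differential Topology*, GTM 33 (1976), Ch. 8. [Hirsch1976]
-/

noncomputable section

open Set Function Metric Real
open scoped ContDiff Topology RealInnerProductSpace

namespace Literature.Topology.FourManifolds

/-! ### The cut-off -/

/-- The cut-off `χ(s) = smoothTransition ((16 s - 1)/3)`: `0` for `s ≤ 1/16`, `1` for `s ≥ 1/4`,
monotone, smooth. [folklore] -/
def starCutoff (s : ℝ) : ℝ := smoothTransition ((16 * s - 1) / 3)

/-- `χ = 0` on `s ≤ 1/16`. [folklore] -/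
theorem starCutoff_of_le {s : ℝ} (h : s ≤ 1 / 16) : starCutoff s = 0 :=
  smoothTransition.zero_of_nonpos (by linarith)

/-- `χ = 1` on `s ≥ 1/4`. [folklore] -/
theorem starCutoff_of_ge {s : ℝ} (h : 1 / 4 ≤ s) : starCutoff s = 1 :=
  smoothTransition.one_of_one_le (by linarith)

/-- `0 ≤ χ`. [folklore] -/
theorem starCutoff_nonneg (s : ℝ) : 0 ≤ starCutoff s := smoothTransition.nonneg _

/-- `χ ≤ 1`. [folklore] -/
theorem starCutoff_le_one (s : ℝ) : starCutoff s ≤ 1 := smoothTransition.le_one _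

/-- `χ` is smooth. [folklore] -/
theorem contDiff_starCutoff {n : ℕ∞} : ContDiff ℝ n starCutoff :=
  smoothTransition.contDiff.comp (((contDiff_const.mul contDiff_id).sub contDiff_const).div_const _)

/-- `χ` is monotone. [folklore] -/
theorem starCutoff_monotone : Monotone starCutoff := fun _ _ h =>
  smoothTransition.monotone (by linarith)

/-- `χ' ≥ 0`. [folklore] -/
theorem deriv_starCutoff_nonneg (s : ℝ) : 0 ≤ deriv starCutoff s :=
  starCutoff_monotone.deriv_nonneg

/-! ### The profile along a ray -/

section Profile

variable {F : Type*}

/-- The **profile** `φᵤ(s) = s (c + χ(s²)(R u - c))` of the star map along the ray of `u`.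
[folklore] -/
def starProfile (R : F → ℝ) (c : ℝ) (u : F) (s : ℝ) : ℝ := s * (c + starCutoff (s ^ 2) * (R u - c))

/-- `φᵤ(0) = 0`. [folklore] -/
@[simp]
theorem starProfile_zero (R : F → ℝ) (c : ℝ) (u : F) : starProfile R c u 0 = 0 := by
  simp [starProfile]

/-- `φᵤ(1) = R u`. [folklore] -/
theorem starProfile_one (R : F → ℝ) (c : ℝ) (u : F) : starProfile R c u 1 = R u := by
  rw [starProfile, one_pow, starCutoff_of_ge (by norm_num)]; ring

/-- The derivative of the profile. [folklore] -/
theorem hasDerivAt_starProfile (R : F → ℝ) (c : ℝ) (u : F) (s : ℝ) :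
    HasDerivAt (starProfile R c u)
      ((c + starCutoff (s ^ 2) * (R u - c)) + s * (deriv starCutoff (s ^ 2) * (2 * s) * (R u - c))) s := by
  have h1 : HasDerivAt (fun s : ℝ => starCutoff (s ^ 2)) (deriv starCutoff (s ^ 2) * (2 * s)) s := by
    have hχ : HasDerivAt starCutoff (deriv starCutoff (s ^ 2)) ((fun s : ℝ => s ^ 2) s) :=
      ((contDiff_starCutoff (n := 1)).differentiable (by simp) _).hasDerivAt
    have hp : HasDerivAt (fun s : ℝ => s ^ 2) (2 * s) s :=
      (hasDerivAt_pow 2 s).congr_deriv (by norm_num)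
    exact HasDerivAt.comp s (h := fun s : ℝ => s ^ 2) (h₂ := starCutoff) hχ hp
  have h2 : HasDerivAt (fun s : ℝ => c + starCutoff (s ^ 2) * (R u - c))
      (deriv starCutoff (s ^ 2) * (2 * s) * (R u - c)) s := by
    simpa using (h1.mul_const (R u - c)).const_add c
  have h3 := (hasDerivAt_id s).mul h2
  have hfun : starProfile R c u = fun s => id s * (c + starCutoff (s ^ 2) * (R u - c)) := rfl
  rw [hfun]
  exact h3.congr_deriv (by simp only [id_eq, one_mul])

/-- The profile is continuous. [folklore] -/
theorem continuous_starProfile (R : F → ℝ) (c : ℝ) (u : F) : Continuous (starProfile R c u) :=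
  continuous_iff_continuousAt.2 fun s => (hasDerivAt_starProfile R c u s).continuousAt

/-- **The profile maps `[0, 1]` onto `[0, R u]`** (intermediate value theorem). [folklore] -/
theorem exists_starProfile_eq (R : F → ℝ) (c : ℝ) (u : F) {r : ℝ} (hr0 : 0 ≤ r) (hr : r ≤ R u) :
    ∃ s ∈ Icc (0 : ℝ) 1, starProfile R c u s = r := by
  have := intermediate_value_Icc zero_le_one (continuous_starProfile R c u).continuousOn
  rw [starProfile_zero, starProfile_one] at this
  exact this ⟨hr0, hr⟩

/-- `φᵤ' ≥ c > 0` for `s ≥ 0` when `c = c₁/2 < c₁ ≤ R u`. [folklore] -/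
theorem le_deriv_starProfile {R : F → ℝ} {c₁ : ℝ} (hc₁ : 0 < c₁) {u : F} (hRu : c₁ ≤ R u) {s : ℝ}
    (hs : 0 ≤ s) : c₁ / 2 ≤ deriv (starProfile R (c₁ / 2) u) s := by
  rw [(hasDerivAt_starProfile R (c₁ / 2) u s).deriv]
  have h1 : 0 ≤ starCutoff (s ^ 2) * (R u - c₁ / 2) := mul_nonneg (starCutoff_nonneg _) (by linarith)
  have h2 : 0 ≤ s * (deriv starCutoff (s ^ 2) * (2 * s) * (R u - c₁ / 2)) := by
    have := deriv_starCutoff_nonneg (s ^ 2)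
    have : 0 ≤ R u - c₁ / 2 := by linarith
    positivity
  linarith

/-- The profile is strictly increasing on `[0, ∞)` (same hypotheses). [folklore] -/
theorem strictMonoOn_starProfile {R : F → ℝ} {c₁ : ℝ} (hc₁ : 0 < c₁) {u : F} (hRu : c₁ ≤ R u) :
    StrictMonoOn (starProfile R (c₁ / 2) u) (Ici 0) := by
  refine strictMonoOn_of_deriv_pos (convex_Ici 0) (continuous_starProfile R _ u).continuousOn
    fun s hs => ?_
  rw [interior_Ici] at hs
  exact lt_of_lt_of_le (by positivity) (le_deriv_starProfile hc₁ hRu (le_of_lt hs))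

/-- `φᵤ(s) ≥ c s`. [folklore] -/
theorem mul_le_starProfile {R : F → ℝ} {c₁ : ℝ} (hc₁ : 0 < c₁) {u : F} (hRu : c₁ ≤ R u) {s : ℝ}
    (hs : 0 ≤ s) : c₁ / 2 * s ≤ starProfile R (c₁ / 2) u s := by
  rw [starProfile]
  have : 0 ≤ starCutoff (s ^ 2) * (R u - c₁ / 2) := mul_nonneg (starCutoff_nonneg _) (by linarith)
  nlinarith

end Profile

/-! ### The map -/

section Normed

variable {F : Type*} [NormedAddCommGroup F]

/-- The coefficient `g x = c + χ(‖x‖²) (R x - c)`. [folklore] -/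
def starCoeff (R : F → ℝ) (c : ℝ) (x : F) : ℝ := c + starCutoff (‖x‖ ^ 2) * (R x - c)

variable {R : F → ℝ} {c₁ c : ℝ}

/-- Near `0` (on `‖x‖ ≤ 1/4`) the coefficient is `c`. [folklore] -/
theorem starCoeff_of_norm_le {x : F} (hx : ‖x‖ ≤ 1 / 4) : starCoeff R c x = c := by
  rw [starCoeff, starCutoff_of_le, zero_mul, add_zero]
  nlinarith [norm_nonneg x]

/-- On `‖x‖ ≥ 1/2` the coefficient is `R x`. [folklore] -/
theorem starCoeff_of_le_norm {x : F} (hx : 1 / 2 ≤ ‖x‖) : starCoeff R c x = R x := by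
  rw [starCoeff, starCutoff_of_ge, one_mul, add_sub_cancel]
  nlinarith

/-- The coefficient is `≥ c` when `c ≤ R x`. [folklore] -/
theorem le_starCoeff {x : F} (hx : c ≤ R x) : c ≤ starCoeff R c x := by
  rw [starCoeff]
  nlinarith [starCutoff_nonneg (‖x‖ ^ 2)]

/-- The constant `c₁/2` is below `R` when `c₁ ≤ R`, `c₁ > 0`. [folklore] -/
theorem half_lt_of_le (hc₁ : 0 < c₁) (hRb : ∀ x : F, x ≠ 0 → c₁ ≤ R x) {x : F} (hx : x ≠ 0) :
    c₁ / 2 < R x := by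
  have := hRb x hx; linarith

/-- The coefficient is positive everywhere (for `c = c₁/2`). [folklore] -/
theorem starCoeff_pos (hc₁ : 0 < c₁) (hRb : ∀ x : F, x ≠ 0 → c₁ ≤ R x) (x : F) :
    0 < starCoeff R (c₁ / 2) x := by
  by_cases hx : x = 0
  · rw [hx, starCoeff, norm_zero, starCutoff_of_le (by norm_num), zero_mul, add_zero]; positivity
  · exact lt_of_lt_of_le (by positivity) (le_starCoeff (half_lt_of_le hc₁ hRb hx).le)

variable [NormedSpace ℝ F]

/-- **The star map** `x ↦ (c + χ(‖x‖²)(R x - c)) • x`: the homothety `c • id` near `0`, and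
`x ↦ R x • x` near the unit sphere and beyond. [folklore] -/
def starMap (R : F → ℝ) (c : ℝ) (x : F) : F := starCoeff R c x • x

/-- `starMap 0 = 0`. [folklore] -/
@[simp]
theorem starMap_zero (R : F → ℝ) (c : ℝ) : starMap R c 0 = 0 := smul_zero _

/-- On unit vectors `starMap u = R u • u`. [folklore] -/
theorem starMap_of_norm_eq_one {u : F} (hu : ‖u‖ = 1) : starMap R c u = R u • u := by
  rw [starMap, starCoeff_of_le_norm (by rw [hu]; norm_num)]

/-- `starMap x = 0 ↔ x = 0`. [folklore] -/
theorem starMap_eq_zero_iff (hc₁ : 0 < c₁) (hRb : ∀ x : F, x ≠ 0 → c₁ ≤ R x) {x : F} :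
    starMap R (c₁ / 2) x = 0 ↔ x = 0 := by
  rw [starMap, smul_eq_zero]
  exact ⟨fun h => h.resolve_left (starCoeff_pos hc₁ hRb x).ne', fun h => Or.inr h⟩

/-- `starMap (s • u) = φᵤ(s) • u` for `s > 0`, `‖u‖ = 1`, `R` homogeneous. [folklore] -/
theorem starMap_smul (hR : ∀ x : F, x ≠ 0 → ∀ s : ℝ, 0 < s → R (s • x) = R x) {u : F}
    (hu : ‖u‖ = 1) {s : ℝ} (hs : 0 < s) : starMap R c (s • u) = starProfile R c u s • u := by
  have hu0 : u ≠ 0 := by rintro rfl; simp at hu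
  rw [starMap, starCoeff, hR u hu0 s hs, norm_smul, Real.norm_of_nonneg hs.le, hu, mul_one,
    smul_smul, starProfile, mul_comm]

/-! ### Injectivity -/

/-- **The star map is injective.** It maps the ray of `u` into itself by the strictly increasing
profile `φᵤ`. [folklore] -/
theorem starMap_injective (hR : ∀ x : F, x ≠ 0 → ∀ s : ℝ, 0 < s → R (s • x) = R x)
    (hc₁ : 0 < c₁) (hRb : ∀ x : F, x ≠ 0 → c₁ ≤ R x) : Injective (starMap R (c₁ / 2)) := by
  intro x y hxy
  by_cases hx : x = 0
  · rw [hx, starMap_zero] at hxy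
    rw [hx]
    exact ((starMap_eq_zero_iff hc₁ hRb).1 hxy.symm).symm
  by_cases hy : y = 0
  · rw [hy, starMap_zero, starMap_eq_zero_iff hc₁ hRb] at hxy
    exact absurd hxy hx
  -- both non-zero: `y` is a positive multiple of `x`
  have hgx := starCoeff_pos hc₁ hRb x
  have hgy := starCoeff_pos hc₁ hRb y
  have hyx : y = (starCoeff R (c₁ / 2) x / starCoeff R (c₁ / 2) y) • x := by
    rw [div_eq_inv_mul, mul_smul, ← starMap, hxy, starMap, smul_smul, inv_mul_cancel₀ hgy.ne',
      one_smul]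
  set μ := starCoeff R (c₁ / 2) x / starCoeff R (c₁ / 2) y with hμ
  have hμpos : 0 < μ := div_pos hgx hgy
  -- write both along the unit vector `u = x/‖x‖`
  set u : F := ‖x‖⁻¹ • x with hu
  have hxn : 0 < ‖x‖ := norm_pos_iff.2 hx
  have hu1 : ‖u‖ = 1 := by rw [hu, norm_smul, norm_inv, norm_norm, inv_mul_cancel₀ hxn.ne']
  have hu0 : u ≠ 0 := by rintro h; rw [h, norm_zero] at hu1; exact zero_ne_one hu1
  have hxu : x = ‖x‖ • u := by rw [hu, smul_smul, mul_inv_cancel₀ hxn.ne', one_smul]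
  have hyu : y = (μ * ‖x‖) • u := by rw [mul_smul, ← hxu]; exact hyx
  rw [hxu, hyu, starMap_smul hR hu1 hxn, starMap_smul hR hu1 (by positivity)] at hxy
  have hprof : starProfile R (c₁ / 2) u ‖x‖ = starProfile R (c₁ / 2) u (μ * ‖x‖) :=
    smul_left_injective ℝ hu0 hxy
  have heq : ‖x‖ = μ * ‖x‖ :=
    (strictMonoOn_starProfile hc₁ (hRb u hu0)).injOn (mem_Ici.2 hxn.le) (mem_Ici.2 (by positivity))
      hprof
  rw [hxu, hyu, ← heq]

/-! ### Images of the ball and of the sphere -/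

/-- **The star map sends the closed unit ball onto the star region** `{0} ∪ {y | ‖y‖ ≤ R y}`.
[folklore] -/
theorem starMap_image_closedBall (hR : ∀ x : F, x ≠ 0 → ∀ s : ℝ, 0 < s → R (s • x) = R x)
    (hc₁ : 0 < c₁) (hRb : ∀ x : F, x ≠ 0 → c₁ ≤ R x) :
    starMap R (c₁ / 2) '' closedBall (0 : F) 1 = {y : F | y = 0 ∨ (y ≠ 0 ∧ ‖y‖ ≤ R y)} := by
  ext y
  simp only [mem_image, mem_closedBall, dist_zero_right, mem_setOf_eq]
  constructor
  · rintro ⟨x, hx, rfl⟩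
    by_cases hx0 : x = 0
    · exact Or.inl (by rw [hx0, starMap_zero])
    · right
      refine ⟨fun h => hx0 ((starMap_eq_zero_iff hc₁ hRb).1 h), ?_⟩
      have hxn : 0 < ‖x‖ := norm_pos_iff.2 hx0
      set u : F := ‖x‖⁻¹ • x with hu
      have hu1 : ‖u‖ = 1 := by rw [hu, norm_smul, norm_inv, norm_norm, inv_mul_cancel₀ hxn.ne']
      have hu0 : u ≠ 0 := by rintro h; rw [h, norm_zero] at hu1; exact zero_ne_one hu1
      have hxu : x = ‖x‖ • u := by rw [hu, smul_smul, mul_inv_cancel₀ hxn.ne', one_smul]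
      rw [hxu, starMap_smul hR hu1 hxn]
      have hprof_pos : 0 < starProfile R (c₁ / 2) u ‖x‖ :=
        lt_of_lt_of_le (by positivity) (mul_le_starProfile hc₁ (hRb u hu0) hxn.le)
      rw [norm_smul, Real.norm_of_nonneg hprof_pos.le, hu1, mul_one, hR u hu0 _ hprof_pos,
        ← starProfile_one R (c₁ / 2) u]
      exact (strictMonoOn_starProfile hc₁ (hRb u hu0)).monotoneOn (mem_Ici.2 hxn.le)
        (mem_Ici.2 zero_le_one) hx
  · rintro (rfl | ⟨hy0, hyR⟩)
    · exact ⟨0, by simp, starMap_zero _ _⟩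
    · have hyn : 0 < ‖y‖ := norm_pos_iff.2 hy0
      set u : F := ‖y‖⁻¹ • y with hu
      have hu1 : ‖u‖ = 1 := by rw [hu, norm_smul, norm_inv, norm_norm, inv_mul_cancel₀ hyn.ne']
      have hyu : y = ‖y‖ • u := by rw [hu, smul_smul, mul_inv_cancel₀ hyn.ne', one_smul]
      have hRu : R u = R y := by rw [hu]; exact hR y hy0 _ (inv_pos.2 hyn)
      obtain ⟨s, hs, hprof⟩ := exists_starProfile_eq R (c₁ / 2) u hyn.le (by rw [hRu]; exact hyR)
      refine ⟨s • u, by rw [norm_smul, hu1, mul_one, Real.norm_of_nonneg hs.1]; exact hs.2, ?_⟩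
      rcases hs.1.eq_or_lt with h | h
      · rw [← h, starProfile_zero] at hprof
        rw [← hprof] at hyn; exact absurd hyn (lt_irrefl 0)
      · rw [starMap_smul hR hu1 h, hprof, ← hyu]

/-- **The star map sends the unit sphere onto the radial graph** `{y ≠ 0 | ‖y‖ = R y}`. [folklore] -/
theorem starMap_image_sphere (hR : ∀ x : F, x ≠ 0 → ∀ s : ℝ, 0 < s → R (s • x) = R x)
    (hc₁ : 0 < c₁) (hRb : ∀ x : F, x ≠ 0 → c₁ ≤ R x) :
    starMap R (c₁ / 2) '' sphere (0 : F) 1 = {y : F | y ≠ 0 ∧ ‖y‖ = R y} := by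
  ext y
  simp only [mem_image, mem_sphere_zero_iff_norm, mem_setOf_eq]
  constructor
  · rintro ⟨u, hu1, rfl⟩
    have hu0 : u ≠ 0 := by rintro h; rw [h, norm_zero] at hu1; exact zero_ne_one hu1
    have hRu : 0 < R u := lt_trans (by positivity) (half_lt_of_le hc₁ hRb hu0)
    rw [starMap_of_norm_eq_one hu1]
    refine ⟨smul_ne_zero hRu.ne' hu0, ?_⟩
    rw [norm_smul, Real.norm_of_nonneg hRu.le, hu1, mul_one, hR u hu0 _ hRu]
  · rintro ⟨hy0, hyR⟩
    have hyn : 0 < ‖y‖ := norm_pos_iff.2 hy0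
    set u : F := ‖y‖⁻¹ • y with hu
    have hu1 : ‖u‖ = 1 := by rw [hu, norm_smul, norm_inv, norm_norm, inv_mul_cancel₀ hyn.ne']
    refine ⟨u, hu1, ?_⟩
    rw [starMap_of_norm_eq_one hu1, hu, hR y hy0 _ (inv_pos.2 hyn), ← hyR, smul_smul,
      mul_inv_cancel₀ hyn.ne', one_smul]

/-! ### Preparations for the calculus -/

/-- The radial derivative of a function that is positively homogeneous of degree `0` vanishes:
`(fderiv R x) x = 0` at a point of differentiability `x ≠ 0`. [folklore] -/
theorem fderiv_apply_self_eq_zero_of_homogeneous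
    (hR : ∀ x : F, x ≠ 0 → ∀ s : ℝ, 0 < s → R (s • x) = R x) {x : F} (hx : x ≠ 0)
    (hd : DifferentiableAt ℝ R x) : fderiv ℝ R x x = 0 := by
  -- `s ↦ R ((1 + s) • x)` is constant near `0`
  have hline : HasDerivAt (fun s : ℝ => R ((1 + s) • x)) (fderiv ℝ R x x) 0 := by
    have h1 : HasDerivAt (fun s : ℝ => (1 + s) • x) x 0 := by
      simpa using ((hasDerivAt_id (0 : ℝ)).const_add 1).smul_const x
    have h2 : HasFDerivAt R (fderiv ℝ R x) ((1 + (0 : ℝ)) • x) := by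
      rw [add_zero, one_smul]; exact hd.hasFDerivAt
    exact h2.comp_hasDerivAt 0 h1
  have hconst : (fun s : ℝ => R ((1 + s) • x)) =ᶠ[𝓝 0] fun _ => R x := by
    filter_upwards [Ioo_mem_nhds (show (-1 : ℝ) < 0 by norm_num) (show (0 : ℝ) < 1 by norm_num)]
      with s hs
    exact hR x hx (1 + s) (by linarith [hs.1])
  have h0 : HasDerivAt (fun s : ℝ => R ((1 + s) • x)) 0 0 :=
    (hasDerivAt_const (0 : ℝ) (R x)).congr_of_eventuallyEq hconst
  exact hline.unique h0

/-- Near `0` the star map is the homothety `c • id`. [folklore] -/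
theorem starMap_eventuallyEq_smul (R : F → ℝ) (c : ℝ) :
    starMap R c =ᶠ[𝓝 (0 : F)] fun y => c • y := by
  filter_upwards [Metric.ball_mem_nhds (0 : F) (show (0 : ℝ) < 1 / 4 by norm_num)] with y hy
  rw [starMap, starCoeff_of_norm_le]
  rw [mem_ball_zero_iff] at hy
  exact hy.le

end Normed

/-! ### Smoothness and the immersion property -/

section Inner

variable {F : Type*} [NormedAddCommGroup F] [InnerProductSpace ℝ F] {R : F → ℝ} {c₁ c : ℝ}

/-- The coefficient `g` is smooth at `x ≠ 0`. [folklore] -/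
theorem contDiffAt_starCoeff (hRd : ∀ x : F, x ≠ 0 → ContDiffAt ℝ ∞ R x) {x : F} (hx : x ≠ 0) :
    ContDiffAt ℝ ∞ (starCoeff R c) x :=
  contDiffAt_const.add ((contDiff_starCutoff.comp (contDiff_norm_sq ℝ)).contDiffAt.mul
    ((hRd x hx).sub contDiffAt_const))

/-- **The star map is smooth.** Near `0` it is `c • id`; elsewhere a product of smooth functions.
[folklore] -/
theorem contDiff_starMap (hRd : ∀ x : F, x ≠ 0 → ContDiffAt ℝ ∞ R x) :
    ContDiff ℝ ∞ (starMap R c) := by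
  refine contDiff_iff_contDiffAt.2 fun x => ?_
  by_cases hx : x = 0
  · rw [hx]
    exact (contDiffAt_id.const_smul c).congr_of_eventuallyEq (starMap_eventuallyEq_smul R c)
  · exact (contDiffAt_starCoeff hRd hx).smul contDiffAt_id

/-- The radial derivative of the coefficient is non-negative: `(Dg_x) x = 2 ‖x‖² χ'(‖x‖²)(R x - c)
≥ 0` — computed along the line `s ↦ (1 + s) • x`, on which `R` is constant. [folklore] -/
theorem fderiv_starCoeff_apply_self_nonneg (hR : ∀ x : F, x ≠ 0 → ∀ s : ℝ, 0 < s → R (s • x) = R x)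
    (hc₁ : 0 < c₁) (hRb : ∀ x : F, x ≠ 0 → c₁ ≤ R x) (hRd : ∀ x : F, x ≠ 0 → ContDiffAt ℝ ∞ R x)
    {x : F} (hx : x ≠ 0) : 0 ≤ fderiv ℝ (starCoeff R (c₁ / 2)) x x := by
  have hgd : DifferentiableAt ℝ (starCoeff R (c₁ / 2)) x :=
    (contDiffAt_starCoeff hRd hx).differentiableAt (by simp)
  -- the derivative along the line `s ↦ (1 + s) • x`
  have hline : HasDerivAt (fun s : ℝ => starCoeff R (c₁ / 2) ((1 + s) • x))
      (fderiv ℝ (starCoeff R (c₁ / 2)) x x) 0 := by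
    have h1 : HasDerivAt (fun s : ℝ => (1 + s) • x) x 0 := by
      simpa using ((hasDerivAt_id (0 : ℝ)).const_add 1).smul_const x
    have h2 : HasFDerivAt (starCoeff R (c₁ / 2)) (fderiv ℝ (starCoeff R (c₁ / 2)) x)
        ((1 + (0 : ℝ)) • x) := by
      rw [add_zero, one_smul]; exact hgd.hasFDerivAt
    exact h2.comp_hasDerivAt 0 h1
  -- explicit form of the coefficient along the line
  have hev : (fun s : ℝ => starCoeff R (c₁ / 2) ((1 + s) • x)) =ᶠ[𝓝 0]
      fun s => c₁ / 2 + starCutoff ((1 + s) ^ 2 * ‖x‖ ^ 2) * (R x - c₁ / 2) := by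
    filter_upwards [Ioo_mem_nhds (show (-1 : ℝ) < 0 by norm_num) (show (0 : ℝ) < 1 by norm_num)]
      with s hs
    have hs1 : 0 < 1 + s := by linarith [hs.1]
    rw [starCoeff, hR x hx (1 + s) hs1, norm_smul, Real.norm_of_nonneg hs1.le, mul_pow]
  have hexp : HasDerivAt (fun s : ℝ => c₁ / 2 + starCutoff ((1 + s) ^ 2 * ‖x‖ ^ 2) * (R x - c₁ / 2))
      (deriv starCutoff (‖x‖ ^ 2) * (2 * ‖x‖ ^ 2) * (R x - c₁ / 2)) 0 := by
    have hi : HasDerivAt (fun s : ℝ => (1 + s) ^ 2 * ‖x‖ ^ 2) (2 * ‖x‖ ^ 2) 0 := by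
      have h1 : HasDerivAt (fun s : ℝ => 1 + s) 1 0 := (hasDerivAt_id (0 : ℝ)).const_add 1
      have h3 := (h1.mul h1).mul_const (‖x‖ ^ 2)
      refine (h3.congr_of_eventuallyEq (Filter.Eventually.of_forall fun s => ?_)).congr_deriv ?_
      · show (1 + s) ^ 2 * ‖x‖ ^ 2 = (1 + s) * (1 + s) * ‖x‖ ^ 2
        ring
      · ring
    have hχ : HasDerivAt starCutoff (deriv starCutoff (‖x‖ ^ 2))
        ((fun s : ℝ => (1 + s) ^ 2 * ‖x‖ ^ 2) 0) := by
      have h0 : (fun s : ℝ => (1 + s) ^ 2 * ‖x‖ ^ 2) 0 = ‖x‖ ^ 2 := by simp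
      rw [h0]
      exact ((contDiff_starCutoff (n := 1)).differentiable (by simp) _).hasDerivAt
    have hcomp := HasDerivAt.comp 0 (h := fun s : ℝ => (1 + s) ^ 2 * ‖x‖ ^ 2) (h₂ := starCutoff) hχ hi
    exact (hcomp.mul_const (R x - c₁ / 2)).const_add (c₁ / 2)
  have hval : fderiv ℝ (starCoeff R (c₁ / 2)) x x =
      deriv starCutoff (‖x‖ ^ 2) * (2 * ‖x‖ ^ 2) * (R x - c₁ / 2) :=
    hline.unique (hexp.congr_of_eventuallyEq hev)
  rw [hval]
  have h1 := deriv_starCutoff_nonneg (‖x‖ ^ 2)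
  have h2 : 0 ≤ R x - c₁ / 2 := by have := (half_lt_of_le hc₁ hRb hx).le; linarith
  positivity

/-- **The star map is an immersion**: its differential is injective at every point. [folklore] -/
theorem fderiv_starMap_injective (hR : ∀ x : F, x ≠ 0 → ∀ s : ℝ, 0 < s → R (s • x) = R x)
    (hc₁ : 0 < c₁) (hRb : ∀ x : F, x ≠ 0 → c₁ ≤ R x) (hRd : ∀ x : F, x ≠ 0 → ContDiffAt ℝ ∞ R x)
    (x : F) : Injective (fderiv ℝ (starMap R (c₁ / 2)) x) := by
  by_cases hx : x = 0
  · -- near `0` the map is `c • id`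
    rw [hx, (starMap_eventuallyEq_smul R (c₁ / 2)).fderiv_eq]
    have hd : HasFDerivAt (fun y : F => (c₁ / 2) • y) ((c₁ / 2) • ContinuousLinearMap.id ℝ F) 0 :=
      (hasFDerivAt_id (0 : F)).const_smul (c₁ / 2)
    rw [hd.fderiv]
    intro v w h
    simpa [hc₁.ne'] using h
  · have hg := contDiffAt_starCoeff (c := c₁ / 2) hRd hx
    have hgd : DifferentiableAt ℝ (starCoeff R (c₁ / 2)) x := hg.differentiableAt (by simp)
    have hD : HasFDerivAt (starMap R (c₁ / 2))
        (starCoeff R (c₁ / 2) x • ContinuousLinearMap.id ℝ F +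
          (fderiv ℝ (starCoeff R (c₁ / 2)) x).smulRight x) x :=
      hgd.hasFDerivAt.fun_smul (hasFDerivAt_id x)
    rw [hD.fderiv]
    intro v w hvw
    rw [← sub_eq_zero] at hvw ⊢
    set z := v - w with hz
    set g := starCoeff R (c₁ / 2) x with hg_def
    set L := fderiv ℝ (starCoeff R (c₁ / 2)) x with hL
    have hz0 : g • z + L z • x = 0 := by
      have : (g • ContinuousLinearMap.id ℝ F + L.smulRight x) z = 0 := by rw [map_sub]; exact hvw
      simpa using this
    have hgpos : 0 < g := starCoeff_pos hc₁ hRb x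
    -- `z = α • x` with `α = -(L z)/g`
    have hzx : z = (-(L z) / g) • x := by
      have h1 : g • z = -(L z • x) := eq_neg_of_add_eq_zero_left hz0
      calc z = g⁻¹ • (g • z) := by rw [smul_smul, inv_mul_cancel₀ hgpos.ne', one_smul]
        _ = (-(L z) / g) • x := by rw [h1, smul_neg, smul_smul, neg_div, neg_smul, div_eq_inv_mul]
    set α := -(L z) / g with hα
    -- plug back: `α (g + L x) • x = 0`
    have hrad : 0 ≤ L x := fderiv_starCoeff_apply_self_nonneg hR hc₁ hRb hRd hx
    have h2 : (α * (g + L x)) • x = 0 := by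
      have : g • z + L z • x = 0 := hz0
      rw [hzx, map_smul, smul_eq_mul, smul_smul, ← add_smul] at this
      convert this using 2; ring
    have h3 : α * (g + L x) = 0 := by
      rcases smul_eq_zero.1 h2 with h | h
      · exact h
      · exact absurd h hx
    have hα0 : α = 0 := by
      rcases mul_eq_zero.1 h3 with h | h
      · exact h
      · linarith
    rw [hzx, hα0, zero_smul]

end Inner

end Literature.Topology.FourManifolds

end
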